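import Summits.AnomalousDissipation.AnomalousDissipation.Theses.TwoAndHalfD
import Literature.Analysis.FunctionSpaces.TorusFourierCalculus
import Literature.Analysis.FunctionSpaces.TorusConvectionLaplacianNormSq
import Literature.Analysis.FunctionSpaces.TorusEnstrophyOrthogonality
import Literature.Analysis.FluidPDE.TorusPressurePoisson

/-!
# Q3 `stub_planarCurlTools` — planar curl: zero mean and the enstrophy identity
# (line `Sketch`, crux stmt-AnomalousDissipation-0206)

Registered tool stub (section Q) of the line `Sketch` for the crux
`Summit.AnomalousDissipation.AnomalousDissipation.Theses.TwoAndHalfD.TwohalfdThesis`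
(stmt-AnomalousDissipation-0206).

CONTENT.  For a smooth planar field `w : T² → ℝ²` with scalar curl `ω = ∂₀w₁ − ∂₁w₀`:

* `pcurl_hasZeroMean` — `∫ ω = 0` (each `∂ᵢwⱼ` has zero mean, `Torus.hasZeroMean_partialDeriv`);
* `pcurl_integral_cross_eq` — the cross identity `∫ ∂₀w₁ ∂₁w₀ = ∫ ∂₁w₁ ∂₀w₀` (two integrations by
  parts, `Torus.integral_partialDeriv_mul_eq_neg_integral`, and Schwarz, `Torus.partialDeriv_comm`);
* `pcurl_sum_norm_sq_eq` — for `div w = 0`, pointwise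
  `∑ᵢ ‖∂ᵢw‖² = ω² + 2 (∂₀w₁ ∂₁w₀ − ∂₁w₁ ∂₀w₀)` (since `∂₀w₀ + ∂₁w₁ = 0`);
* `pcurl_toReal_eGradNormSq_eq_scalarL2Sq` — hence `‖∇w‖₂² = ‖ω‖₂²` for divergence-free `w`, with the
  spectral `Torus.eGradNormSq` converted by `Torus.gradNormSq_eq_toReal_eGradNormSq_holds`
  (Doering–Gibbon 1995, (1.29): `‖∇u‖₂ = ‖ω‖₂` for periodic divergence-free fields);
* `stub_planarCurlTools` — the registered conjunction.

Supports stmt-AnomalousDissipation-0206.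

## Mathlib / Literature search

`lean search 'gradNormSq_eq_toReal_eGradNormSq_holds'` (`TorusFourierCalculus`),
`'hasZeroMean_partialDeriv'` (`TorusConvectionLaplacianNormSq`), `'integral_partialDeriv_mul_eq_neg_integral'`
(`TorusPressurePoisson`), `'partialDeriv_comm|partialDeriv_apply_coord'` (`TorusEnstrophyOrthogonality`);
the tree has the identity `‖ω‖₂² = eGradNormSq v` only in the weak/spectral form
(`…TwohalfdNegWeakCurlWitness.ofReal_scalarL2Sq_re_eq_eGradNormSq`, via Fourier coefficients), not the
smooth physical-space statement needed here.  `lean search 'pcurl_'`: no clashes.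
-/

noncomputable section

-- the summit path AnomalousDissipation/AnomalousDissipation duplicates a namespace component
set_option linter.dupNamespace false

namespace Summit.AnomalousDissipation.AnomalousDissipation.Theorems.TwohalfdThesis

open MeasureTheory Set Filter Topology
open scoped ENNReal NNReal InnerProductSpace
open Literature.Analysis.FunctionSpaces Literature.Analysis.FluidPDE

/-- **The planar curl of a smooth field has zero mean**: `∫ (∂₀w₁ − ∂₁w₀) = 0` on `T²`
(`∂ᵢ(wⱼ) = (∂ᵢw)ⱼ`, `Torus.partialDeriv_apply_coord`, and `∫ ∂ᵢf = 0`,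
`Torus.hasZeroMean_partialDeriv`). [folklore] -/
theorem pcurl_hasZeroMean {w : UnitAddTorus (Fin 2) → EuclideanSpace ℝ (Fin 2)}
    (hw : Torus.IsSmooth w) :
    Torus.HasZeroMean (fun x => Torus.partialDeriv 0 w x 1 - Torus.partialDeriv 1 w x 0) := by
  have hw1 : Torus.IsContDiff 1 w := hw.isContDiff (by simp)
  have h0 := Torus.hasZeroMean_partialDeriv (hw.apply 1) 0
  have h1 := Torus.hasZeroMean_partialDeriv (hw.apply 0) 1
  rw [Torus.HasZeroMean] at h0 h1 ⊢
  simp_rw [← Torus.partialDeriv_apply_coord hw1]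
  rw [integral_sub ((hw.apply 1).partialDeriv 0).integrable ((hw.apply 0).partialDeriv 1).integrable,
    h0, h1, sub_zero]

/-- **The cross identity** `∫ (∂₀w)₁ (∂₁w)₀ = ∫ (∂₁w)₁ (∂₀w)₀` for a smooth planar field (integrate by
parts in `x₀`, commute `∂₀∂₁ = ∂₁∂₀` on `w₀`, integrate by parts in `x₁`; no boundary on the torus).
[folklore] -/
theorem pcurl_integral_cross_eq {w : UnitAddTorus (Fin 2) → EuclideanSpace ℝ (Fin 2)}
    (hw : Torus.IsSmooth w) :
    ∫ x, Torus.partialDeriv 0 w x 1 * Torus.partialDeriv 1 w x 0 =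
      ∫ x, Torus.partialDeriv 1 w x 1 * Torus.partialDeriv 0 w x 0 := by
  have hw1 : Torus.IsContDiff 1 w := hw.isContDiff (by simp)
  have hf : Torus.IsSmooth (fun y => w y 1) := hw.apply 1
  have he : Torus.IsSmooth (fun y => w y 0) := hw.apply 0
  simp_rw [← Torus.partialDeriv_apply_coord hw1]
  rw [Torus.integral_partialDeriv_mul_eq_neg_integral hf (he.partialDeriv 1) 0,
    Torus.integral_partialDeriv_mul_eq_neg_integral hf (he.partialDeriv 0) 1]
  congr 1
  refine integral_congr_ae (ae_of_all _ fun x => ?_)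
  simp only [Torus.partialDeriv_comm he 0 1 x]

/-- **Pointwise enstrophy bookkeeping** for a smooth divergence-free planar field:
`∑ᵢ ‖∂ᵢw‖² = (∂₀w₁ − ∂₁w₀)² + 2 ((∂₀w)₁ (∂₁w)₀ − (∂₁w)₁ (∂₀w)₀)`, because
`∑ᵢ ‖∂ᵢw‖² = ∑ᵢⱼ (∂ᵢw)ⱼ²` and `(∂₀w)₀ + (∂₁w)₁ = div w = 0`. [folklore] -/
theorem pcurl_sum_norm_sq_eq {w : UnitAddTorus (Fin 2) → EuclideanSpace ℝ (Fin 2)}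
    (hw : Torus.IsSmooth w) (hdiv : Torus.IsDivFree w) (x : UnitAddTorus (Fin 2)) :
    ∑ i, ‖Torus.partialDeriv i w x‖ ^ 2 =
      (Torus.partialDeriv 0 w x 1 - Torus.partialDeriv 1 w x 0) ^ 2 +
        2 * (Torus.partialDeriv 0 w x 1 * Torus.partialDeriv 1 w x 0 -
          Torus.partialDeriv 1 w x 1 * Torus.partialDeriv 0 w x 0) := by
  have hw1 : Torus.IsContDiff 1 w := hw.isContDiff (by simp)
  have hd := hdiv x
  rw [Torus.divergence_eq_sum_partialDeriv_apply hw1, Fin.sum_univ_two] at hd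
  rw [Fin.sum_univ_two, EuclideanSpace.real_norm_sq_eq, EuclideanSpace.real_norm_sq_eq,
    Fin.sum_univ_two, Fin.sum_univ_two]
  linear_combination (Torus.partialDeriv 0 w x 0 + Torus.partialDeriv 1 w x 1) * hd

/-- **Enstrophy equals the squared `L²` norm of the vorticity** for a smooth divergence-free planar
field: `‖∇w‖₂² = ‖∂₀w₁ − ∂₁w₀‖₂²`, with the spectral `Torus.eGradNormSq` on the left
(`Torus.gradNormSq_eq_toReal_eGradNormSq_holds`) and `Torus.scalarL2Sq` on the right: integrate
`pcurl_sum_norm_sq_eq` and kill the cross term by `pcurl_integral_cross_eq`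
(Doering–Gibbon 1995, (1.29)). [folklore] -/
theorem pcurl_toReal_eGradNormSq_eq_scalarL2Sq {w : UnitAddTorus (Fin 2) → EuclideanSpace ℝ (Fin 2)}
    (hw : Torus.IsSmooth w) (hdiv : Torus.IsDivFree w) :
    (Torus.eGradNormSq w).toReal =
      Torus.scalarL2Sq (fun x => Torus.partialDeriv 0 w x 1 - Torus.partialDeriv 1 w x 0) := by
  -- the entries `(∂ᵢw)ⱼ` are smooth real functions
  have hP : ∀ i j : Fin 2, Torus.IsSmooth (fun x => Torus.partialDeriv i w x j) := fun i j =>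
    (hw.partialDeriv i).apply j
  have hω : Torus.IsSmooth (fun x => Torus.partialDeriv 0 w x 1 - Torus.partialDeriv 1 w x 0) :=
    (hP 0 1).sub (hP 1 0)
  have hω2 : Torus.IsSmooth
      (fun x => (Torus.partialDeriv 0 w x 1 - Torus.partialDeriv 1 w x 0) ^ 2) :=
    ContDiff.pow hω 2
  have hA : Torus.IsSmooth (fun x => Torus.partialDeriv 0 w x 1 * Torus.partialDeriv 1 w x 0) :=
    ContDiff.mul (hP 0 1) (hP 1 0)
  have hB : Torus.IsSmooth (fun x => Torus.partialDeriv 1 w x 1 * Torus.partialDeriv 0 w x 0) :=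
    ContDiff.mul (hP 1 1) (hP 0 0)
  have hAB : Torus.IsSmooth (fun x => Torus.partialDeriv 0 w x 1 * Torus.partialDeriv 1 w x 0 -
      Torus.partialDeriv 1 w x 1 * Torus.partialDeriv 0 w x 0) := hA.sub hB
  have h2AB : Torus.IsSmooth (fun x => 2 * (Torus.partialDeriv 0 w x 1 * Torus.partialDeriv 1 w x 0 -
      Torus.partialDeriv 1 w x 1 * Torus.partialDeriv 0 w x 0)) :=
    ContDiff.mul contDiff_const hAB
  rw [← Torus.gradNormSq_eq_toReal_eGradNormSq_holds hw, Torus.gradNormSq, Torus.scalarL2Sq]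
  simp_rw [pcurl_sum_norm_sq_eq hw hdiv]
  rw [integral_add hω2.integrable h2AB.integrable, integral_const_mul,
    integral_sub hA.integrable hB.integrable, pcurl_integral_cross_eq hw, sub_self, mul_zero, add_zero]

/-- **Q3 `stub_planarCurlTools` — planar curl: zero mean and the enstrophy identity.**  For a smooth
planar field `w` on `T²`: (i) `∫ (∂₀w₁ − ∂₁w₀) = 0` (`pcurl_hasZeroMean`); (ii) if moreover `div w = 0`,
then `‖∇w‖₂² = ‖∂₀w₁ − ∂₁w₀‖₂²` with the spectral `Torus.eGradNormSq` (`toReal`)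
(`pcurl_toReal_eGradNormSq_eq_scalarL2Sq`). [folklore] -/
theorem stub_planarCurlTools :
    (∀ w : (UnitAddTorus (Fin 2)) → (EuclideanSpace ℝ (Fin 2)), Torus.IsSmooth w →
        Torus.HasZeroMean (fun x => Torus.partialDeriv 0 w x 1 - Torus.partialDeriv 1 w x 0)) ∧
    (∀ w : (UnitAddTorus (Fin 2)) → (EuclideanSpace ℝ (Fin 2)), Torus.IsSmooth w → Torus.IsDivFree w →
        (Torus.eGradNormSq w).toReal =
          Torus.scalarL2Sq (fun x => Torus.partialDeriv 0 w x 1 - Torus.partialDeriv 1 w x 0)) :=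
  ⟨fun _ hw => pcurl_hasZeroMean hw, fun _ hw hdiv => pcurl_toReal_eGradNormSq_eq_scalarL2Sq hw hdiv⟩

end Summit.AnomalousDissipation.AnomalousDissipation.Theorems.TwohalfdThesis
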